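import Literature.MathematicalPhysics.QuantumFieldTheory.ConformalBootstrap3D.MixedBlockLeadingTrajectory
import Mathlib.Topology.Algebra.Order.Field
import HarnessLib

/-!
# The pole of the mixed-channel blocks at the 3D unitarity bound: residue = shifted block

Kos–Poland–Simmons-Duffin 2014 §4 (eqs. (4.2)–(4.3), Table 1): as a function of `Δ` the conformal block
`g^{Δ₁₂,Δ₃₄}_{Δ,ℓ}` is meromorphic with simple poles, and the residue at a pole `Δ_i` is a constant times the
block of the null descendant, `g_{Δ,ℓ} ~ c_i/(Δ - Δ_i) · g_{Δ_i + n_i, ℓ_i}`. The third family of their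
Table 1, `Δ = ℓ + d - 1 - k`, at `k = 1` and `d = 3` is the unitarity bound `Δ = ℓ + 1` of a spin-`ℓ ≥ 1`
primary; the null descendant is the spin-`(ℓ-1)` operator of dimension `ℓ + 2`, and the residue is proportional
to `Δ₁₂ Δ₃₄`, i.e. to `ab` (`a = -Δ₁₂/2`, `b = Δ₃₄/2`) — it vanishes for the equal-dimension blocks (the
Hogervorst–Rychkov "shortening") and NOT for the mixed families `gmm`, `gpm` of the `σ–ε` system
(pub-ising3d AXIOMS-SOURCES S8.4; tree `hrCoeffAB_one_pred`: `A_{1,ℓ-1}(a,b) = (Δ-ℓ-1+2a)(Δ-ℓ-1+2b)ℓ /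
(2(2ℓ+1)(Δ-ℓ-1))`).

This file PROVES the `k = 1` statement at `d = 3` for the `z`-series coefficient arrays of
`MixedBlockCoefficients` (Dolan–Osborn 2004 §3 recursion, Hogervorst–Rychkov normalisation), directly from the
recursion — no residue formula is assumed (in Kos–Poland–Simmons-Duffin 2014 the general residues are
"guess[ed] … and check[ed]", and Penedones–Trevisani–Yamazaki 2016 derive type III only modulo a conjectured
norm; the `k = 1` case below is elementary):

* `hrResidueConst a b ℓ = (2a)(2b) ℓ / (2(2ℓ+1))` — the residue of `A_{1,ℓ-1}`;
* `casimirPivot3D_bound_succ` — at `Δ = ℓ+1` the level-`(n+1)` pivots of the spin-`ℓ` recursion ARE the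
  level-`n` pivots of the recursion for `(Δ', ℓ') = (ℓ+2, ℓ-1)`: `C_{ℓ+1+n+1,j} - C_{ℓ+1,ℓ} = C_{ℓ+2+n,j} - C_{ℓ+2,ℓ-1}`
  (because `C_{ℓ+1,ℓ} = C_{ℓ+2,ℓ-1}`: the null state has the same Casimir);
* `tendsto_sub_mul_hrCoeffAB` — **for every `ℓ ≥ 1`, `N ≥ 1`, `j`, `a`, `b`:
  `(Δ - ℓ - 1) · A_{N,j}(a,b; Δ, ℓ) → hrResidueConst a b ℓ · A_{N-1,j}(a,b; ℓ+2, ℓ-1)` as `Δ → ℓ+1`, `Δ ≠ ℓ+1`.**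
  I.e. the residue ARRAY of the spin-`ℓ` block at its unitarity bound is the residue constant times the array of
  the genuine block `g^{Δ₁₂,Δ₃₄}_{ℓ+2,ℓ-1}` (same external dimensions), shifted by one level. The leading
  trajectory (`j = ℓ+N`, regular at the bound) is included: there both sides are `0`.

Consequences recorded for the certificate design (pub-ising3d AXIOMS-SOURCES §9 R9, §10 S10.3): the "residue
row" of a mixed-system functional at the bound of spin `ℓ` is `hrResidueConst · (functional applied to the typed
block at (ℓ+2, ℓ-1))`, with `hrResidueConst < 0` for `gmm` (`ab = -Δ_σε²/4`) and `> 0` for `gpm`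
(`ab = +Δ_σε²/4`) (`hrResidueConst_neg_of_mul_neg` / `_pos_of_mul_pos`); the point `(ℓ+2, ℓ-1)` lies strictly
above the unitarity bound of spin `ℓ-1`, so every pivot met there is positive (`casimirPivot3D_pos`) and the
evaluator theorems for regular points apply to the residue block whenever `(ℓ+2, ℓ-1)` is not an accidental
degeneracy.

Numerical companion (exact rationals, not part of the proofs): pub-ising3d-lit-g3 `code/check_residue_family3_k1.py`
(levels ≤ 7, six parameter sets incl. the `σε` values; ALL-OK).

References: F. Kos, D. Poland, D. Simmons-Duffin, JHEP 11 (2014) 109, §4 eqs. (4.2)–(4.3) and Table 1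
[cite: KosPolandSimmonsduffin2014, §4 eqs. (4.2)–(4.3)]; F. A. Dolan, H. Osborn, Nucl. Phys. B 678 (2004) 491,
§3 eqs. (3.11)–(3.13) [cite: DolanOsborn2004, §3 eqs. (3.11)–(3.12)]; M. Hogervorst, H. Osborn, S. Rychkov,
JHEP 08 (2013) 014, App. A (the same pole, "a₁ → ∞ for a or b nonzero") [cite: HogervorstOsbornRychkov2013, App. A].
-/

namespace Literature.MathematicalPhysics.QuantumFieldTheory.ConformalBootstrap3D

open Set Filter Topology

/-! ### The residue constant and the pivot identity at the bound -/

/-- The residue of `A_{1,ℓ-1}(a,b; Δ, ℓ)` at `Δ = ℓ + 1`: `(2a)(2b) ℓ / (2(2ℓ+1))`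
(`hrCoeffAB_one_pred`; Kos–Poland–Simmons-Duffin 2014 Table 1, family 3, `k = 1`, at `d = 3`, in
Hogervorst–Rychkov normalisation). [cite: KosPolandSimmonsduffin2014, §4 Table 1] -/
noncomputable def hrResidueConst (a b : ℝ) (ℓ : ℕ) : ℝ :=
  (2 * a) * (2 * b) * (ℓ : ℝ) / (2 * (2 * (ℓ : ℝ) + 1))

/-- The residue constant is negative when `ab < 0` (the `⟨σεσε⟩` family `gmm`, `a = -b ≠ 0`) and `ℓ ≥ 1`.
[cite: KosPolandSimmonsduffin2014, §4 Table 1] -/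
theorem hrResidueConst_neg_of_mul_neg {a b : ℝ} {ℓ : ℕ} (hab : a * b < 0) (hℓ : 1 ≤ ℓ) :
    hrResidueConst a b ℓ < 0 := by
  unfold hrResidueConst
  have hℓ' : (1 : ℝ) ≤ ℓ := by exact_mod_cast hℓ
  have hnum : (2 * a) * (2 * b) * (ℓ : ℝ) < 0 := by nlinarith
  exact div_neg_of_neg_of_pos hnum (by positivity)

/-- The residue constant is positive when `ab > 0` (the `⟨εσσε⟩` family `gpm`, `a = b ≠ 0`) and `ℓ ≥ 1`.
[cite: KosPolandSimmonsduffin2014, §4 Table 1] -/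
theorem hrResidueConst_pos_of_mul_pos {a b : ℝ} {ℓ : ℕ} (hab : 0 < a * b) (hℓ : 1 ≤ ℓ) :
    0 < hrResidueConst a b ℓ := by
  unfold hrResidueConst
  have hℓ' : (1 : ℝ) ≤ ℓ := by exact_mod_cast hℓ
  have hnum : 0 < (2 * a) * (2 * b) * (ℓ : ℝ) := by nlinarith
  positivity

/-- It vanishes for the equal-dimension blocks (`ab = 0`): the Hogervorst–Rychkov shortening.
[cite: HogervorstRychkov2013, §3 eq. (3.10)] -/
theorem hrResidueConst_eq_zero_of_mul_eq_zero {a b : ℝ} (hab : a * b = 0) (ℓ : ℕ) :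
    hrResidueConst a b ℓ = 0 := by
  unfold hrResidueConst
  have : (2 * a) * (2 * b) * (ℓ : ℝ) = 4 * (a * b) * ℓ := by ring
  rw [this, hab]
  simp

/-- **The null state has the same Casimir**: at `Δ = ℓ + 1` the level-`(n+1)`, spin-`j` pivot of the spin-`ℓ`
recursion equals the level-`n`, spin-`j` pivot of the recursion at `(Δ', ℓ') = (ℓ+2, ℓ-1)`
(`C_{ℓ+1,ℓ} = C_{ℓ+2,ℓ-1} = (ℓ+1)(ℓ-1)` in the `d = 3` normalisation). [cite: KosPolandSimmonsduffin2014, §4 eq. (4.3)] -/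
theorem casimirPivot3D_bound_succ {ℓ : ℕ} (hℓ : 1 ≤ ℓ) (n j : ℕ) :
    casimirPivot3D ((ℓ : ℝ) + 1) ℓ (n + 1) j = casimirPivot3D ((ℓ : ℝ) + 2) (ℓ - 1) n j := by
  obtain ⟨m, rfl⟩ : ∃ m, ℓ = m + 1 := ⟨ℓ - 1, by omega⟩
  unfold casimirPivot3D
  simp only [Nat.add_sub_cancel]
  push_cast
  ring

/-! ### Continuity of the recursion data in `Δ` -/

/-- `Δ ↦ γ⁺_{Δ+c,j}(a,b)` is continuous. [folklore] -/
theorem continuous_hrGammaPlusAB (a b c : ℝ) (j : ℕ) :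
    Continuous fun Δ : ℝ => hrGammaPlusAB a b (Δ + c) j := by
  unfold hrGammaPlusAB
  fun_prop

/-- `Δ ↦ γ⁻_{Δ+c,j}(a,b)` is continuous. [folklore] -/
theorem continuous_hrGammaMinusAB (a b c : ℝ) (j : ℕ) :
    Continuous fun Δ : ℝ => hrGammaMinusAB a b (Δ + c) j := by
  unfold hrGammaMinusAB
  fun_prop

/-- `Δ ↦ C_{Δ+n,j} - C_{Δ,ℓ}` is continuous. [folklore] -/
theorem continuous_casimirPivot3D (ℓ n j : ℕ) : Continuous fun Δ : ℝ => casimirPivot3D Δ ℓ n j := by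
  unfold casimirPivot3D
  fun_prop

/-! ### The residue theorem -/

section Residue

variable (a b : ℝ)

/-- The regularised array `(Δ - ℓ - 1) · A_{n,j}(a,b;Δ,ℓ)` obeys the same recursion (it is linear).
[cite: DolanOsborn2004, §3 eq. (3.12)] -/
theorem sub_mul_hrCoeffAB_succ (Δ : ℝ) (ℓ n j : ℕ) :
    (Δ - ℓ - 1) * hrCoeffAB a b Δ ℓ (n + 1) j =
      ((if j = 0 then 0 else hrGammaPlusAB a b (Δ + n) (j - 1) * ((Δ - ℓ - 1) * hrCoeffAB a b Δ ℓ n (j - 1)))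
        + hrGammaMinusAB a b (Δ + n) (j + 1) * ((Δ - ℓ - 1) * hrCoeffAB a b Δ ℓ n (j + 1))) /
        casimirPivot3D Δ ℓ (n + 1) j := by
  rw [hrCoeffAB_succ, ← mul_div_assoc]
  congr 1
  split_ifs <;> ring

/-- **One step of the limit recursion.** If the regularised parents `(Δ-ℓ-1)A_{n,j∓1}` have limits `L₁, L₂` as
`Δ → ℓ+1` (`Δ ≠ ℓ+1`) and the pivot of `(n+1, j)` does not vanish at the bound, then `(Δ-ℓ-1)A_{n+1,j}` tends
to the value given by the recursion at `Δ = ℓ+1`. [cite: DolanOsborn2004, §3 eq. (3.12)] -/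
theorem tendsto_sub_mul_hrCoeffAB_succ {ℓ n j : ℕ} {L₁ L₂ : ℝ}
    (h₁ : Tendsto (fun Δ : ℝ => (Δ - ℓ - 1) * hrCoeffAB a b Δ ℓ n (j - 1)) (𝓝[≠] ((ℓ : ℝ) + 1)) (𝓝 L₁))
    (h₂ : Tendsto (fun Δ : ℝ => (Δ - ℓ - 1) * hrCoeffAB a b Δ ℓ n (j + 1)) (𝓝[≠] ((ℓ : ℝ) + 1)) (𝓝 L₂))
    (hp : casimirPivot3D ((ℓ : ℝ) + 1) ℓ (n + 1) j ≠ 0) :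
    Tendsto (fun Δ : ℝ => (Δ - ℓ - 1) * hrCoeffAB a b Δ ℓ (n + 1) j) (𝓝[≠] ((ℓ : ℝ) + 1))
      (𝓝 (((if j = 0 then 0 else hrGammaPlusAB a b ((ℓ : ℝ) + 1 + n) (j - 1) * L₁)
        + hrGammaMinusAB a b ((ℓ : ℝ) + 1 + n) (j + 1) * L₂) / casimirPivot3D ((ℓ : ℝ) + 1) ℓ (n + 1) j)) := by
  have hfun : (fun Δ : ℝ => (Δ - ℓ - 1) * hrCoeffAB a b Δ ℓ (n + 1) j) = fun Δ : ℝ =>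
      ((if j = 0 then 0 else hrGammaPlusAB a b (Δ + n) (j - 1) * ((Δ - ℓ - 1) * hrCoeffAB a b Δ ℓ n (j - 1)))
        + hrGammaMinusAB a b (Δ + n) (j + 1) * ((Δ - ℓ - 1) * hrCoeffAB a b Δ ℓ n (j + 1))) /
        casimirPivot3D Δ ℓ (n + 1) j := funext fun Δ => sub_mul_hrCoeffAB_succ a b Δ ℓ n j
  rw [hfun]
  have hγp : Tendsto (fun Δ : ℝ => hrGammaPlusAB a b (Δ + n) (j - 1)) (𝓝[≠] ((ℓ : ℝ) + 1))
      (𝓝 (hrGammaPlusAB a b ((ℓ : ℝ) + 1 + n) (j - 1))) :=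
    ((continuous_hrGammaPlusAB a b n (j - 1)).tendsto _).mono_left nhdsWithin_le_nhds
  have hγm : Tendsto (fun Δ : ℝ => hrGammaMinusAB a b (Δ + n) (j + 1)) (𝓝[≠] ((ℓ : ℝ) + 1))
      (𝓝 (hrGammaMinusAB a b ((ℓ : ℝ) + 1 + n) (j + 1))) :=
    ((continuous_hrGammaMinusAB a b n (j + 1)).tendsto _).mono_left nhdsWithin_le_nhds
  have hpiv : Tendsto (fun Δ : ℝ => casimirPivot3D Δ ℓ (n + 1) j) (𝓝[≠] ((ℓ : ℝ) + 1))
      (𝓝 (casimirPivot3D ((ℓ : ℝ) + 1) ℓ (n + 1) j)) :=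
    ((continuous_casimirPivot3D ℓ (n + 1) j).tendsto _).mono_left nhdsWithin_le_nhds
  refine Tendsto.div (Tendsto.add ?_ (hγm.mul h₂)) hpiv hp
  by_cases hj : j = 0
  · simp only [hj, if_true]
    exact tendsto_const_nhds
  · simp only [hj, if_false]
    exact hγp.mul h₁

/-- Level zero: `(Δ-ℓ-1) A_{0,j} → 0`. [folklore] -/
theorem tendsto_sub_mul_hrCoeffAB_zero (ℓ j : ℕ) :
    Tendsto (fun Δ : ℝ => (Δ - ℓ - 1) * hrCoeffAB a b Δ ℓ 0 j) (𝓝[≠] ((ℓ : ℝ) + 1)) (𝓝 0) := by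
  have hfun : (fun Δ : ℝ => (Δ - ℓ - 1) * hrCoeffAB a b Δ ℓ 0 j) =
      fun Δ : ℝ => (Δ - ℓ - 1) * (if j = ℓ then 1 else 0) := by
    funext Δ
    by_cases h : j = ℓ
    · subst h; simp
    · rw [hrCoeffAB_zero_of_ne a b Δ h, if_neg h]
  rw [hfun]
  have hc : Continuous fun Δ : ℝ => (Δ - ℓ - 1) * (if j = ℓ then (1 : ℝ) else 0) := by fun_prop
  have h0 : ((ℓ : ℝ) + 1 - ℓ - 1) * (if j = ℓ then (1 : ℝ) else 0) = 0 := by ring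
  have := (hc.tendsto ((ℓ : ℝ) + 1)).mono_left (nhdsWithin_le_nhds (s := {((ℓ : ℝ) + 1)}ᶜ))
  rwa [h0] at this

/-- **Level one**: `(Δ-ℓ-1) A_{1,j}(a,b;Δ,ℓ) → hrResidueConst a b ℓ · A_{0,j}(a,b;ℓ+2,ℓ-1)` (`= hrResidueConst`
for `j = ℓ-1`, the pole; `= 0` otherwise), `ℓ ≥ 1`. [cite: KosPolandSimmonsduffin2014, §4 eqs. (4.2)–(4.3)] -/
theorem tendsto_sub_mul_hrCoeffAB_one {ℓ : ℕ} (hℓ : 1 ≤ ℓ) (j : ℕ) :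
    Tendsto (fun Δ : ℝ => (Δ - ℓ - 1) * hrCoeffAB a b Δ ℓ 1 j) (𝓝[≠] ((ℓ : ℝ) + 1))
      (𝓝 (hrResidueConst a b ℓ * hrCoeffAB a b ((ℓ : ℝ) + 2) (ℓ - 1) 0 j)) := by
  by_cases hj : j = ℓ - 1
  · -- the pole: `(Δ-ℓ-1) A_{1,ℓ-1} = γ⁻_{Δ,ℓ}/2` for `Δ ≠ ℓ+1`
    subst hj
    rw [hrCoeffAB_zero_self, mul_one]
    have heq : ∀ Δ ∈ ({((ℓ : ℝ) + 1)}ᶜ : Set ℝ),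
        hrGammaMinusAB a b (Δ + 0) ℓ / 2 = (Δ - ℓ - 1) * hrCoeffAB a b Δ ℓ 1 (ℓ - 1) := by
      intro Δ hΔ
      have hne : Δ - (ℓ : ℝ) - 1 ≠ 0 := by
        intro h0; apply hΔ; simp only [Set.mem_singleton_iff]; linarith
      rw [hrCoeffAB_one_pred hℓ hne, add_zero]
      unfold hrGammaMinusAB
      have h2 : (2 : ℝ) * (ℓ : ℝ) + 1 ≠ 0 := by positivity
      field_simp
    refine tendsto_nhdsWithin_congr heq ?_
    have hc := (((continuous_hrGammaMinusAB a b 0 ℓ).div_const 2).tendsto ((ℓ : ℝ) + 1)).mono_left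
      (nhdsWithin_le_nhds (s := ({((ℓ : ℝ) + 1)}ᶜ : Set ℝ)))
    have hval : hrGammaMinusAB a b ((ℓ : ℝ) + 1 + 0) ℓ / 2 = hrResidueConst a b ℓ := by
      unfold hrGammaMinusAB hrResidueConst
      have h2 : (2 : ℝ) * (ℓ : ℝ) + 1 ≠ 0 := by positivity
      field_simp
      ring
    rwa [hval] at hc
  · -- off the pole: the target is `0`
    rw [hrCoeffAB_zero_of_ne a b _ hj, mul_zero]
    by_cases hr : InDescendantRange ℓ 1 j
    · -- then `j = ℓ + 1`, regular pivot `2(2ℓ+1)`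
      obtain ⟨h1, h2, h3⟩ := hr
      have hj' : j = ℓ + 1 := by omega
      subst hj'
      have hp : casimirPivot3D ((ℓ : ℝ) + 1) ℓ (0 + 1) (ℓ + 1) ≠ 0 := by
        have := casimirPivot3D_leading ((ℓ : ℝ) + 1) ℓ 0
        simp only [Nat.cast_zero, zero_add, add_zero] at this
        rw [show ℓ + 0 + 1 = ℓ + 1 by ring] at this
        rw [this]
        positivity
      have h := tendsto_sub_mul_hrCoeffAB_succ a b (tendsto_sub_mul_hrCoeffAB_zero a b ℓ (ℓ + 1 - 1))
        (tendsto_sub_mul_hrCoeffAB_zero a b ℓ (ℓ + 1 + 1)) hp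
      simpa using h
    · have hfun : (fun Δ : ℝ => (Δ - ℓ - 1) * hrCoeffAB a b Δ ℓ 1 j) = fun _ => 0 := by
        funext Δ
        rw [hrCoeffAB_eq_zero_of_not_inDescendantRange a b Δ hr, mul_zero]
      rw [hfun]
      exact tendsto_const_nhds

/-- **The residue theorem** (Kos–Poland–Simmons-Duffin 2014 §4, family 3, `k = 1`, at `d = 3`, from the
recursion): for `ℓ ≥ 1`, every level `n + 1 ≥ 1` and every spin `j`,
`(Δ - ℓ - 1) · A_{n+1,j}(a,b; Δ, ℓ) → hrResidueConst a b ℓ · A_{n,j}(a,b; ℓ+2, ℓ-1)` as `Δ → ℓ + 1`, `Δ ≠ ℓ+1`: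
the residue array at the unitarity bound is the residue constant times the array of the block of the null
descendant `(Δ', ℓ') = (ℓ+2, ℓ-1)` with the same `(Δ₁₂, Δ₃₄)`. [cite: KosPolandSimmonsduffin2014, §4 eqs. (4.2)–(4.3)] -/
theorem tendsto_sub_mul_hrCoeffAB {ℓ : ℕ} (hℓ : 1 ≤ ℓ) :
    ∀ n j : ℕ, Tendsto (fun Δ : ℝ => (Δ - ℓ - 1) * hrCoeffAB a b Δ ℓ (n + 1) j) (𝓝[≠] ((ℓ : ℝ) + 1))
      (𝓝 (hrResidueConst a b ℓ * hrCoeffAB a b ((ℓ : ℝ) + 2) (ℓ - 1) n j)) := by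
  intro n
  induction n with
  | zero => exact tendsto_sub_mul_hrCoeffAB_one a b hℓ
  | succ n ih =>
    intro j
    -- the bound of spin `ℓ - 1` lies below `ℓ + 2`
    have hΔ' : unitarityBound3D (ℓ - 1) < (ℓ : ℝ) + 2 := by
      unfold unitarityBound3D
      split_ifs with h0
      · have : (0 : ℝ) ≤ ℓ := Nat.cast_nonneg ℓ
        linarith
      · have : ((ℓ - 1 : ℕ) : ℝ) = (ℓ : ℝ) - 1 := by
          rw [Nat.cast_sub hℓ, Nat.cast_one]
        rw [this]; linarith
    by_cases hr : InDescendantRange (ℓ - 1) (n + 1) j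
    · -- regular pivot: the recursion passes to the limit
      obtain ⟨h1, h2, h3⟩ := hr
      have hpiv' : 0 < casimirPivot3D ((ℓ : ℝ) + 2) (ℓ - 1) (n + 1) j :=
        casimirPivot3D_pos hΔ' (by omega) h1 h2 h3
      have hp : casimirPivot3D ((ℓ : ℝ) + 1) ℓ (n + 1 + 1) j ≠ 0 := by
        rw [casimirPivot3D_bound_succ hℓ]; exact hpiv'.ne'
      have h := tendsto_sub_mul_hrCoeffAB_succ a b (ih (j - 1)) (ih (j + 1)) hp
      refine h.congr' (Eventually.of_forall fun _ => rfl) |>.mono_right (le_of_eq ?_)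
      congr 1
      rw [hrCoeffAB_succ, casimirPivot3D_bound_succ hℓ, ← mul_div_assoc]
      congr 1
      have hcast : ((ℓ : ℝ) + 1 + ((n + 1 : ℕ) : ℝ)) = (ℓ : ℝ) + 2 + (n : ℝ) := by push_cast; ring
      rw [hcast]
      split_ifs <;> ring
    · -- off the shifted range the target is `0`
      rw [hrCoeffAB_eq_zero_of_not_inDescendantRange a b _ hr, mul_zero]
      by_cases hR : InDescendantRange ℓ (n + 1 + 1) j
      · -- only the leading coefficient `j = ℓ + n + 2` remains
        obtain ⟨h1, h2, h3⟩ := hR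
        have hj : j = ℓ + (n + 1) + 1 := by
          unfold InDescendantRange at hr
          omega
        subst hj
        have hp : casimirPivot3D ((ℓ : ℝ) + 1) ℓ (n + 1 + 1) (ℓ + (n + 1) + 1) ≠ 0 :=
          (casimirPivot3D_leading_pos (by positivity : (0 : ℝ) < (ℓ : ℝ) + 1 + ℓ) (n + 1)).ne'
        have hz1 : hrCoeffAB a b ((ℓ : ℝ) + 2) (ℓ - 1) n (ℓ + (n + 1) + 1 - 1) = 0 :=
          hrCoeffAB_eq_zero_of_not_inDescendantRange a b _ (fun ⟨_, h2', _⟩ => by omega)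
        have hz2 : hrCoeffAB a b ((ℓ : ℝ) + 2) (ℓ - 1) n (ℓ + (n + 1) + 1 + 1) = 0 :=
          hrCoeffAB_eq_zero_of_not_inDescendantRange a b _ (fun ⟨_, h2', _⟩ => by omega)
        have i1 := ih (ℓ + (n + 1) + 1 - 1)
        have i2 := ih (ℓ + (n + 1) + 1 + 1)
        rw [hz1, mul_zero] at i1
        rw [hz2, mul_zero] at i2
        have h := tendsto_sub_mul_hrCoeffAB_succ a b i1 i2 hp
        simpa using h
      · have hfun : (fun Δ : ℝ => (Δ - ℓ - 1) * hrCoeffAB a b Δ ℓ (n + 1 + 1) j) = fun _ => 0 := by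
          funext Δ
          rw [hrCoeffAB_eq_zero_of_not_inDescendantRange a b Δ hR, mul_zero]
        rw [hfun]
        exact tendsto_const_nhds

/-- The same with the level written as `N ≥ 1`. [cite: KosPolandSimmonsduffin2014, §4 eqs. (4.2)–(4.3)] -/
theorem tendsto_sub_mul_hrCoeffAB_of_pos {ℓ : ℕ} (hℓ : 1 ≤ ℓ) {N : ℕ} (hN : 1 ≤ N) (j : ℕ) :
    Tendsto (fun Δ : ℝ => (Δ - ℓ - 1) * hrCoeffAB a b Δ ℓ N j) (𝓝[≠] ((ℓ : ℝ) + 1))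
      (𝓝 (hrResidueConst a b ℓ * hrCoeffAB a b ((ℓ : ℝ) + 2) (ℓ - 1) (N - 1) j)) := by
  obtain ⟨n, rfl⟩ : ∃ n, N = n + 1 := ⟨N - 1, by omega⟩
  simpa using tendsto_sub_mul_hrCoeffAB a b hℓ n j

/-- **On the leading trajectory the block is regular at the bound**: `(Δ-ℓ-1) A_{N,ℓ+N} → 0`.
[cite: KosPolandSimmonsduffin2014, §4 eq. (4.2)] -/
theorem tendsto_sub_mul_hrCoeffAB_leading {ℓ : ℕ} (hℓ : 1 ≤ ℓ) (N : ℕ) :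
    Tendsto (fun Δ : ℝ => (Δ - ℓ - 1) * hrCoeffAB a b Δ ℓ N (ℓ + N)) (𝓝[≠] ((ℓ : ℝ) + 1)) (𝓝 0) := by
  rcases Nat.eq_zero_or_pos N with hN | hN
  · subst hN
    simpa using tendsto_sub_mul_hrCoeffAB_zero a b ℓ (ℓ + 0)
  · have h := tendsto_sub_mul_hrCoeffAB_of_pos a b hℓ hN (ℓ + N)
    have hz : hrCoeffAB a b ((ℓ : ℝ) + 2) (ℓ - 1) (N - 1) (ℓ + N) = 0 :=
      hrCoeffAB_eq_zero_of_not_inDescendantRange a b _ (fun ⟨_, h2, _⟩ => by omega)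
    rwa [hz, mul_zero] at h

/-- For the equal-dimension blocks (`ab = 0`) every regularised coefficient tends to `0`: no pole
(Hogervorst–Rychkov shortening). [cite: HogervorstRychkov2013, §3 eq. (3.10)] -/
theorem tendsto_sub_mul_hrCoeffAB_of_mul_eq_zero {ℓ : ℕ} (hℓ : 1 ≤ ℓ) (hab : a * b = 0) {N : ℕ}
    (hN : 1 ≤ N) (j : ℕ) :
    Tendsto (fun Δ : ℝ => (Δ - ℓ - 1) * hrCoeffAB a b Δ ℓ N j) (𝓝[≠] ((ℓ : ℝ) + 1)) (𝓝 0) := by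
  have h := tendsto_sub_mul_hrCoeffAB_of_pos a b hℓ hN j
  rwa [hrResidueConst_eq_zero_of_mul_eq_zero hab, zero_mul] at h

end Residue

end Literature.MathematicalPhysics.QuantumFieldTheory.ConformalBootstrap3D
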